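import Mathlib
import Literature.Computability.AlgebraicComplexity.RealTauKnownCases
import Summits.ValiantsHypothesis.ValiantsHypothesis.Theorems.LacunarySymmetroidMatrixDescartesStubDescartesCeiling
import Summits.ValiantsHypothesis.ValiantsHypothesis.Theorems.LacunarySymmetroidMatrixDescartesCommonDirectionFactor
import Summits.ValiantsHypothesis.ValiantsHypothesis.Theorems.LacunarySymmetroidMatrixDescartesCommonDirectionJointRank

/-!
# `MatrixDescartes` (stmt-ValiantsHypothesis-18050) — the COMMON-DIRECTION LOW-RANK SECTOR, part 4: the ROW-BUDGET form
# and the BORDERED (cross-supported) sector — perturbations living on a fixed cross of `r` rows and `r` columns count like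
# format `(2r, K)`: `Z₊ + 1 ≤ (K − 1) + C(K + 2r − 1, 2r)`, size-free

HONEST FRAMING.  Cell `pub-symmetroid`, seat `val-sym-mdr-p2` (gen 18); helper file `--supports` the crux
`Theses.LacunarySymmetroid.MatrixDescartes`, NO closure claim.  It abstracts parts 1–3 (`…CommonDirectionFactor`,
`…CommonDirection`, `…CommonDirectionJointRank`, this session) into a ROW-BUDGET lemma and applies it to one more natural family;
nothing here bears on the crux in its window, on `DoorA26`/`DoorA34`, registers, or `VP ≠ VNP`.

THE ROW-BUDGET FORM.  Letters `Sₗ = cₗ • B + Wₗ`, `φ = ∑ₗ C(cₗ)X^{dₗ}`.  Call `ρ ≤ m` a ROW BUDGET if every row choice `g` with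
`det N_g ≠ 0` takes at most `ρ` rows from the perturbations.  Then (`det_pencil_eq_mul_of_rowBudget`, `card_support_hB_le`,
`ceiling_of_rowBudget`) **`det F = φ^(m − ρ) · h`, `#supp h ≤ C(K + ρ − 1, ρ)`, `Z₊ + 1 ≤ (K − 1) + C(K + ρ − 1, ρ)`.**  Row budgets
of record: `ρ = ∑ rank Wₗ` (part 1), `ρ =` stacked rank (part 3), and — new here — `ρ = 2r` for the BORDERED SECTOR: all `Wₗ`
supported on a fixed cross `(R × all) ∪ (all × R)` with `|R| = r` (at most `r` perturbation rows inside `R`, and the rows outside `R`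
live in `span{e_j : j ∈ R}`, so at most `r` of them are independent).  The stacked rank of a bordered family can be `(K+1)r`; the
row budget `2r` is `K`-free, so for fixed `r` the count is POLYNOMIAL in `K` at every size (`commonDirection_bordered_ceiling`):

  `Z₊ + 1 ≤ (K − 1) + C(K + 2r − 1, 2r)`   (when `2r ≤ m`; in general with `min(2r, m)`).

Example: every letter agrees with `cₗ • B` outside the first `r` rows and columns («arrowhead-type corrections of width `r` to a common
direction»).  Elementary; axioms `propext`, `Classical.choice`, `Quot.sound`; no definitions (file-local notation as in parts 1–3).
-/

-- layout Summits/ValiantsHypothesis/ValiantsHypothesis forces the duplicated namespace component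
set_option linter.dupNamespace false

namespace Summit.ValiantsHypothesis.ValiantsHypothesis.Theorems.LacunarySymmetroidMatrixDescartes

open Polynomial Finset
open scoped BigOperators Polynomial

/-- the scalar `K`-nomial `φ = ∑ₗ C(cₗ) X^{dₗ}` carrying the common direction (as in parts 1–3) -/
local notation3 (prettyPrint := false) "φ[" d ", " c "]" =>
  (∑ l, Polynomial.C (c l) * (Polynomial.X : Polynomial ℝ) ^ (d l))

/-- the real matrix `N_g` of a row choice `g` (as in parts 1–3) -/
local notation3 (prettyPrint := false) "N[" B ", " W ", " g "]" =>
  (Matrix.of fun i j => Option.elim (g i) B W i j)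

/-- number of rows in which the row choice `g` picks the piece `o` (as in parts 1–3) -/
local notation3 (prettyPrint := false) "cnt[" g ", " o "]" =>
  (Finset.univ.filter fun i => g i = o).card

/-- the row-budget cofactor `h_ρ` of `det F = φ^(m − ρ) · h_ρ` (same expression as part 3's `hJ` with `ρ` for the stacked rank) -/
local notation3 (prettyPrint := false) "hB[" m ", " ρ ", " d ", " B ", " c ", " W "]" =>
  (∑ g : Fin m → Option (Fin _),
    φ[d, c] ^ (cnt[g, none] - (m - ρ)) * (Polynomial.X : Polynomial ℝ) ^ (∑ i, (g i).elim 0 d)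
      * Polynomial.C (Matrix.det N[B, W, g]))

namespace CommonDirection

variable {K m : ℕ}

/-- **ROW-BUDGET FACTORISATION**: if every surviving row choice takes at most `ρ` perturbation rows then
`det (∑ₗ X^{dₗ}(cₗ • B + Wₗ)) = φ^(m − ρ) · h_ρ`. [folklore] -/
theorem det_pencil_eq_mul_of_rowBudget (d : Fin K → ℕ) (B : Matrix (Fin m) (Fin m) ℝ) (c : Fin K → ℝ)
    (W : Fin K → Matrix (Fin m) (Fin m) ℝ) (ρ : ℕ)
    (hρ : ∀ g : Fin m → Option (Fin K), Matrix.det N[B, W, g] ≠ 0 → (univ.filter fun i => g i ≠ none).card ≤ ρ) :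
    Matrix.det (∑ l, ((X : ℝ[X]) ^ d l) • (c l • B + W l).map C) =
      φ[d, c] ^ (m - ρ) * hB[m, ρ, d, B, c, W] := by
  rw [det_pencil_eq_sum, Finset.mul_sum]
  refine Finset.sum_congr rfl fun g _ => ?_
  rw [sum_ind_eq]
  by_cases hz : Matrix.det N[B, W, g] = 0
  · rw [hz, map_zero, mul_zero, mul_zero, mul_zero]
  · have h1 := hρ g hz
    have h2 := card_wRows_add_cnt_none g
    have hcnt : m - ρ ≤ cnt[g, none] := by omega
    rw [← mul_assoc, ← mul_assoc, ← pow_add, Nat.add_sub_cancel' hcnt]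

/-- **Support of the row-budget cofactor** (`ρ ≤ m`): every exponent of `h_ρ` is a sum of exactly `ρ` exponents `dₗ` with repetition.
[folklore] -/
theorem support_hB_subset (hK : 0 < K) (d : Fin K → ℕ) (B : Matrix (Fin m) (Fin m) ℝ) (c : Fin K → ℝ)
    (W : Fin K → Matrix (Fin m) (Fin m) ℝ) (ρ : ℕ) (hρm : ρ ≤ m)
    (hρ : ∀ g : Fin m → Option (Fin K), Matrix.det N[B, W, g] ≠ 0 → (univ.filter fun i => g i ≠ none).card ≤ ρ) :
    (hB[m, ρ, d, B, c, W]).support ⊆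
      (Finset.univ : Finset (Sym (Fin K) ρ)).image (fun s : Sym (Fin K) ρ => ((s : Multiset (Fin K)).map d).sum) := by
  intro k hk
  rw [mem_support_iff, finsetSum_coeff] at hk
  obtain ⟨g, -, hg⟩ := Finset.exists_ne_zero_of_sum_ne_zero hk
  rw [coeff_mul_C, coeff_mul_X_pow'] at hg
  have hdet : Matrix.det N[B, W, g] ≠ 0 := by
    intro h0
    exact hg (by rw [h0, mul_zero])
  have hle : (∑ i, (g i).elim 0 d) ≤ k := by
    by_contra hlt
    exact hg (by rw [if_neg hlt, zero_mul])
  rw [if_pos hle] at hg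
  set E := cnt[g, none] - (m - ρ) with hE
  have hcoeff : (φ[d, c] ^ E).coeff (k - ∑ i, (g i).elim 0 d) ≠ 0 := fun h0 => hg (by rw [h0, zero_mul])
  have hmemφ : (k - ∑ i, (g i).elim 0 d) ∈ (φ[d, c] ^ E).support := mem_support_iff.2 hcoeff
  rw [← det_scalar_pencil d c E] at hmemφ
  obtain ⟨s', -, hs'⟩ := Finset.mem_image.1
    (StubDescartesCeiling.support_det_pencil_subset d (fun l => c l • (1 : Matrix (Fin E) (Fin E) ℝ)) hmemφ)
  have hw := hρ g hdet
  have hm := card_wRows_add_cnt_none g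
  set l₀ : Fin K := ⟨0, hK⟩
  set sW : Multiset (Fin K) := ((univ.filter fun i => g i ≠ none).val).map (fun i => (g i).getD l₀) with hsW
  have hcard : Multiset.card ((s' : Multiset (Fin K)) + sW) = ρ := by
    rw [Multiset.card_add, Sym.card_coe, hsW, card_wMultiset]
    omega
  refine Finset.mem_image.2 ⟨⟨(s' : Multiset (Fin K)) + sW, hcard⟩, Finset.mem_univ _, ?_⟩
  change (((s' : Multiset (Fin K)) + sW).map d).sum = k
  rw [Multiset.map_add, Multiset.sum_add, hsW, sum_map_wMultiset, hs']
  omega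

/-- **Monomial count of the row-budget cofactor**: `#supp h_ρ ≤ C(K + ρ − 1, ρ)`. [folklore] -/
theorem card_support_hB_le (hK : 0 < K) (d : Fin K → ℕ) (B : Matrix (Fin m) (Fin m) ℝ) (c : Fin K → ℝ)
    (W : Fin K → Matrix (Fin m) (Fin m) ℝ) (ρ : ℕ) (hρm : ρ ≤ m)
    (hρ : ∀ g : Fin m → Option (Fin K), Matrix.det N[B, W, g] ≠ 0 → (univ.filter fun i => g i ≠ none).card ≤ ρ) :
    (hB[m, ρ, d, B, c, W]).support.card ≤ Nat.choose (K + ρ - 1) ρ := by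
  refine (Finset.card_le_card (support_hB_subset hK d B c W ρ hρm hρ)).trans (Finset.card_image_le.trans ?_)
  rw [Finset.card_univ, Sym.card_sym_eq_choose, Fintype.card_fin]

/-- **ROW-BUDGET CEILING (size-free)**: a row budget `ρ ≤ m` gives `Z₊ + 1 ≤ (K − 1) + C(K + ρ − 1, ρ)`. [folklore] -/
theorem ceiling_of_rowBudget (hK : 0 < K) (d : Fin K → ℕ) (B : Matrix (Fin m) (Fin m) ℝ) (c : Fin K → ℝ)
    (W : Fin K → Matrix (Fin m) (Fin m) ℝ) (ρ : ℕ) (hρm : ρ ≤ m)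
    (hρ : ∀ g : Fin m → Option (Fin K), Matrix.det N[B, W, g] ≠ 0 → (univ.filter fun i => g i ≠ none).card ≤ ρ) :
    ((Matrix.det (∑ l, ((Polynomial.X : Polynomial ℝ) ^ d l) • (c l • B + W l).map Polynomial.C)
        ).roots.toFinset.filter (fun t => 0 < t)).card + 1 ≤ (K - 1) + Nat.choose (K + ρ - 1) ρ := by
  have hch : 1 ≤ Nat.choose (K + ρ - 1) ρ := Nat.choose_pos (by omega)
  by_cases hP : Matrix.det (∑ l, ((Polynomial.X : Polynomial ℝ) ^ d l) • (c l • B + W l).map Polynomial.C) = 0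
  · rw [hP, Polynomial.roots_zero, Multiset.toFinset_zero, Finset.filter_empty, Finset.card_empty, zero_add]
    omega
  · rw [det_pencil_eq_mul_of_rowBudget d B c W ρ hρ] at hP ⊢
    have hφ : φ[d, c] ^ (m - ρ) ≠ 0 := left_ne_zero_of_mul hP
    have hh : hB[m, ρ, d, B, c, W] ≠ 0 := right_ne_zero_of_mul hP
    rw [Polynomial.roots_mul hP, Multiset.toFinset_add, Finset.filter_union]
    have h1 := card_posRoots_phi_pow_le hK d c _ hφ
    have h2 :=
      Literature.Computability.AlgebraicComplexity.card_roots_toFinset_filter_pos_lt_card_support hh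
    have h3 := card_support_hB_le hK d B c W ρ hρm hρ
    calc ((φ[d, c] ^ (m - ρ)).roots.toFinset.filter (fun t => 0 < t) ∪
            (hB[m, ρ, d, B, c, W]).roots.toFinset.filter (fun t => 0 < t)).card + 1
        ≤ (((φ[d, c] ^ (m - ρ)).roots.toFinset.filter (fun t => 0 < t)).card +
            ((hB[m, ρ, d, B, c, W]).roots.toFinset.filter (fun t => 0 < t)).card) + 1 :=
          Nat.add_le_add_right (Finset.card_union_le _ _) 1
      _ ≤ (K - 1) + Nat.choose (K + ρ - 1) ρ := by omega

/-! ## The bordered sector: perturbations on a fixed cross of rows and columns -/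

/-- Rows outside the cross are supported on the cross columns: such a row lies in `span {e_j : j ∈ R}`. [folklore] -/
theorem row_mem_span_of_support {R : Finset (Fin m)} {w : Fin m → ℝ} (hw : ∀ j, j ∉ R → w j = 0) :
    w ∈ Submodule.span ℝ (Set.range fun j : R => (Pi.single (j : Fin m) (1 : ℝ) : Fin m → ℝ)) := by
  rw [pi_eq_sum_univ' w]
  refine Submodule.sum_mem _ fun j _ => ?_
  by_cases hj : j ∈ R
  · exact Submodule.smul_mem _ _ (Submodule.subset_span ⟨⟨j, hj⟩, rfl⟩)
  · rw [hw j hj, zero_smul]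
    exact Submodule.zero_mem _

/-- **Bordered perturbations have row budget `2|R|`**: if every `Wₗ` vanishes off the cross `(R × all) ∪ (all × R)`, a surviving row
choice takes at most `|R|` perturbation rows inside `R` and at most `|R|` outside (they live in an `|R|`-dimensional space). [folklore] -/
theorem rowBudget_of_bordered (B : Matrix (Fin m) (Fin m) ℝ) (W : Fin K → Matrix (Fin m) (Fin m) ℝ) (R : Finset (Fin m))
    (hW : ∀ l i j, i ∉ R → j ∉ R → W l i j = 0) (g : Fin m → Option (Fin K))
    (hg : Matrix.det N[B, W, g] ≠ 0) : (univ.filter fun i => g i ≠ none).card ≤ 2 * R.card := by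
  classical
  -- split the perturbation rows into those inside and outside `R`
  have hsplit : (univ.filter fun i => g i ≠ none).card
      = ((univ.filter fun i => g i ≠ none).filter (fun i => i ∈ R)).card
        + ((univ.filter fun i => g i ≠ none).filter (fun i => i ∉ R)).card :=
    (Finset.card_filter_add_card_filter_not (s := univ.filter fun i => g i ≠ none) (fun i => i ∈ R)).symm
  have hin : ((univ.filter fun i => g i ≠ none).filter (fun i => i ∈ R)).card ≤ R.card :=
    Finset.card_le_card fun i hi => (Finset.mem_filter.1 hi).2
  -- the outside rows are linearly independent rows of `N_g` inside an `|R|`-dimensional span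
  set T := (univ.filter fun i => g i ≠ none).filter (fun i => i ∉ R) with hT
  have hout : T.card ≤ R.card := by
    by_contra hlt
    apply hg
    apply Matrix.det_eq_zero_of_not_linearIndependent_rows
    intro hli
    have hsub : LinearIndependent ℝ (fun i : T => N[B, W, g] i.1) := hli.comp _ Subtype.val_injective
    have hcard := finrank_span_eq_card hsub
    have hrange : ∀ i : T, N[B, W, g] i.1
        ∈ Submodule.span ℝ (Set.range fun j : R => (Pi.single (j : Fin m) (1 : ℝ) : Fin m → ℝ)) := by
      intro i
      have hi := Finset.mem_filter.1 i.2
      obtain ⟨l, hl⟩ := Option.ne_none_iff_exists'.1 (Finset.mem_filter.1 hi.1).2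
      refine row_mem_span_of_support fun j hj => ?_
      simp only [Matrix.of_apply, hl, Option.elim_some]
      exact hW l i.1 j hi.2 hj
    have hle : Module.finrank ℝ (Submodule.span ℝ (Set.range fun i : T => N[B, W, g] i.1))
        ≤ Module.finrank ℝ (Submodule.span ℝ (Set.range fun j : R => (Pi.single (j : Fin m) (1 : ℝ) : Fin m → ℝ))) :=
      Submodule.finrank_mono (Submodule.span_le.2 (by rintro _ ⟨i, rfl⟩; exact hrange i))
    have hR : Module.finrank ℝ (Submodule.span ℝ (Set.range fun j : R => (Pi.single (j : Fin m) (1 : ℝ) : Fin m → ℝ)))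
        = R.card := by
      have hliR : LinearIndependent ℝ (fun j : R => (Pi.single (j : Fin m) (1 : ℝ) : Fin m → ℝ)) :=
        (Pi.linearIndependent_single_one (Fin m) ℝ).comp _ Subtype.val_injective
      rw [finrank_span_eq_card hliR, Fintype.card_coe]
    rw [hcard, hR, Fintype.card_coe] at hle
    exact hlt hle
  omega

end CommonDirection

open CommonDirection in
/-- **BORDERED COMMON-DIRECTION CEILING (size-free).**  For every `K ≥ 1`, every size `m`, all exponents `d`, every real `m × m` matrix
`B`, all reals `cₗ`, every index set `R` of `r` rows/columns with `2r ≤ m`, and all real `Wₗ` vanishing off the cross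
`(R × all) ∪ (all × R)`: the pencil `∑ₗ X^{dₗ}(cₗ • B + Wₗ)` — every letter equal to `cₗ • B` outside `r` fixed rows and columns — has
`Z₊ + 1 ≤ (K − 1) + C(K + 2r − 1, 2r)` distinct positive determinant zeros: the sector counts like format `(2r, K)`, independently of `m`,
polynomially in `K` for fixed `r`. [folklore] -/
theorem commonDirection_bordered_ceiling {K m : ℕ} (hK : 0 < K) (d : Fin K → ℕ) (B : Matrix (Fin m) (Fin m) ℝ)
    (c : Fin K → ℝ) (W : Fin K → Matrix (Fin m) (Fin m) ℝ) (R : Finset (Fin m)) (hRm : 2 * R.card ≤ m)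
    (hW : ∀ l i j, i ∉ R → j ∉ R → W l i j = 0) :
    ((Matrix.det (∑ l, ((Polynomial.X : Polynomial ℝ) ^ d l) • (c l • B + W l).map Polynomial.C)
        ).roots.toFinset.filter (fun t => 0 < t)).card + 1 ≤ (K - 1) + Nat.choose (K + 2 * R.card - 1) (2 * R.card) :=
  ceiling_of_rowBudget hK d B c W (2 * R.card) hRm (fun g hg => rowBudget_of_bordered B W R hW g hg)

end Summit.ValiantsHypothesis.ValiantsHypothesis.Theorems.LacunarySymmetroidMatrixDescartes
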